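import Summits.Ventures.PercRepro.S2IndepSetCount

/-!
# PercRepro — S2: THE INDEPENDENT `6`-SETS AGAINST THE TRIANGLES (p7, gen 4; the `q = 6` instance of S2IndepSetCount, for S3)

`#{independent 6-sets} + s₃·C(n − 3, 3) ≤ C(n, 6) + C(s₃, 2)·(n − 5)` (`ncard_indep_six_add_le`): the generic lemma
`S2.ncard_indep_add_le` at `q = 6`, with `C(n − 5, 1) = n − 5`. Axioms: standard.
-/

open scoped Matroid

namespace PercRepro

namespace S2

variable {α : Type} {M : Matroid α}

/-- **The independent `6`-sets against the triangles**: `#{independent 6-sets} + s₃·C(n − 3, 3) ≤ C(n, 6) + C(s₃, 2)·(n − 5)`. -/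
theorem ncard_indep_six_add_le [M.Finite] (hC1 : ∀ L ⊆ M.E, M.eRk L = 2 → L.ncard ≤ 3) :
    {B : Set α | B ⊆ M.E ∧ B.ncard = 6 ∧ M.eRk B = 6}.ncard +
      {C : Set α | M.IsCircuit C ∧ C.ncard = 3}.ncard * (M.E.ncard - 3).choose 3 ≤
      M.E.ncard.choose 6 + ({C : Set α | M.IsCircuit C ∧ C.ncard = 3}.ncard).choose 2 * (M.E.ncard - 5) := by
  have h := ncard_indep_add_le hC1 6 (by norm_num)
  simpa [Nat.choose_one_right] using h

end S2

end PercRepro
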